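import Mathlib.Topology.Algebra.ClopenNhdofOne
import Literature.IUT.HodgeTheaters.TemperedCoverings
import Literature.IUT.HodgeTheaters.CommensuratorLemmas
import HarnessLib

/-!
# [IUTchI] §2: the inference structure of Prop. 2.1 – Cor. 2.5 (kurims pp. 45–51), PROOFS

Mochizuki, *Inter-universal Teichmüller theory I: construction of Hodge theaters*, kurims
manuscript (May 2020), §2 [cite: Mochizuki2012, §2 pp.45-51] (D-0012 claim key; series status
DISPUTED).  PROOF-ONLY companion of `Literature.IUT.HodgeTheaters.TemperedCoverings`
(abc-iut-L5-t1): no new definitions; nothing printed is asserted outright.  What is kernel-checked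
here is the DEDUCTION STRUCTURE that the printed proofs state in so many words — "Assertion (i)
follows immediately from Proposition 2.2" (p. 48), "assertion (iv) follows immediately from
assertion (i)" (p. 49), "the commensurable terminality of `Π^tp_X` in `Π̂_X` then follows immediately
from the commensurable terminality of `Δ^tp_X` in `Δ̂_X`" (p. 51), "it thus follows from
Proposition 2.4, (ii), that …" / "by applying Proposition 2.4, (i), to the unique maximal pro-`Σ`
subgroup of `I_x`" (proof of Cor. 2.5, p. 51), "by allowing, in Proposition 2.1, `Λ` to range over
the open subgroups of any verticial subgroup … we conclude … that `Π^tp_𝔾` is commensurably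
terminal in `Π̂_𝔾`" (proof of Prop. 2.2, p. 45) — as implications between the `Prop`-valued
predicates of the statement file, over ARBITRARY data `D`.  The deep inputs ([SemiAnbd] Thm. 3.7
(iii) / 5.4 (ii), Cor. 2.7 (i), [AbsTopII] Prop. 1.3 (iv)) enter only through the hypotheses
"Prop. 2.1 / 2.2 / 2.4 hold for `D`"; the printed "atoms" the proofs use (a verticial subgroup —
an infinite compact subgroup all of whose finite index subgroups are open, Rmk. 2.5.3 (iii) (O3)
p. 56 [NS]; "`D_x` is compact and surjects onto an open subgroup of `G_k`"; "the unique maximal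
pro-`Σ` subgroup of `I_x`") are explicit hypotheses, since the statement file records `Π^tp_𝔾`,
`D_x`, `I_x` as bare data.

Main results: `TemperedGraphGroupData.tp_isCommensurablyTerminal_of_prop21` (Prop. 2.2 "in
particular" ⇐ Prop. 2.1), `….prop22_of_prop21` (all of Prop. 2.2 ⇐ Prop. 2.1, its `ℍ`-instance,
"[SemiAnbd] Cor. 2.7 (i)"'s analogue and `Π̂_ℍ = cl Π^tp_ℍ`), `….temperedNormallyTerminal_of_prop21`
(Rmk. 2.2.2); `StableCurveTemperedData.cor23i_of_prop22` (Cor. 2.3 (i) ⇐ Prop. 2.2),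
`….piXH_inf_delta_of_cor23i` (exactness at `Δ_{X,ℍ}` in Cor. 2.3 (iii) ⇐ (i)),
`….cor23iv_of_cor23i` (Cor. 2.3 (iv) ⇐ (i) + (iii)), `….prop24iii_of_delta` (Prop. 2.4 (iii) ⇐
its `Δ`-half), `….cor25Decomposition_of_prop24ii`, `….cor25Inertia_of_prop24i` (Cor. 2.5 ⇐
Prop. 2.4).  The pro-`Σ` Sylow step of Prop. 2.4 (iii) is in `TemperedCoveringsCompactSubgroups`; the
abstract group theory is in `CommensuratorLemmas`.
-/

namespace Literature.IUT.HodgeTheaters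

open Pointwise Topology
open Literature.AnabelianGeometry.AbsoluteAnabelian (IsCommensurablyTerminal IsNormallyTerminal)
open Literature.AnabelianGeometry.SemiGraphs (IsProSigma)
open Literature.IUT.HodgeTheaters.IsCommensurablyTerminal (comap_of_surjective of_map_injective
  of_subgroupOf)

universe u

/-! ### Verticial subgroups: "the open subgroups of a verticial subgroup" (pp. 45, 51) -/

section Verticial

/-- "The open subgroups of a verticial subgroup" (pp. 45, 51): in a topological group `T`, let
`V` be an infinite compact subgroup all of whose finite index subgroups are open [(O3), p. 56], and
`N ⊆ T` a finite index subgroup; then `V ∩ N` is a nontrivial compact subgroup of `T`, open in `V`.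
[cite: Mochizuki2012, Prop 2.2 p.45] -/
theorem inf_isCompact_of_finiteIndex {T : Type*} [Group T] [TopologicalSpace T]
    [IsTopologicalGroup T] {V : Subgroup T} (hVc : IsCompact (V : Set T))
    (hVinf : (V : Set T).Infinite)
    (hVopen : ∀ W : Subgroup ↥V, W.FiniteIndex → IsOpen (W : Set ↥V))
    (N : Subgroup T) [hN : N.FiniteIndex] :
    IsCompact ((V ⊓ N : Subgroup T) : Set T) ∧ V ⊓ N ≠ ⊥ ∧
      IsOpen (((V ⊓ N).subgroupOf V : Subgroup V) : Set V) := by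
  set W : Subgroup V := (V ⊓ N).subgroupOf V with hW
  haveI hWfi : W.FiniteIndex := by
    refine ⟨fun h0 => hN.index_ne_zero ?_⟩
    change (V ⊓ N).relIndex V = 0 at h0
    rw [Subgroup.inf_relIndex_left] at h0
    exact Subgroup.index_eq_zero_of_relIndex_eq_zero h0
  have hWopen : IsOpen (W : Set V) := hVopen W hWfi
  haveI : CompactSpace V := isCompact_iff_compactSpace.mp hVc
  have hWcompact : IsCompact (W : Set V) := (Subgroup.isClosed_of_isOpen W hWopen).isCompact
  have hcoe : ((V ⊓ N : Subgroup T) : Set T) = Subtype.val '' (W : Set V) := by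
    rw [hW, ← Subgroup.coe_subtype, ← Subgroup.coe_map, Subgroup.subgroupOf_map_subtype,
      inf_eq_left.mpr inf_le_left]
  refine ⟨by rw [hcoe]; exact hWcompact.image continuous_subtype_val, fun hbot => ?_, hWopen⟩
  haveI : Infinite V := Set.infinite_coe_iff.mpr hVinf
  apply hWfi.index_ne_zero
  rw [hW, hbot, Subgroup.bot_subgroupOf, Subgroup.index_bot, Nat.card_eq_zero_of_infinite]

end Verticial

/-! ### Proposition 2.2 and Remark 2.2.2 from Proposition 2.1 (pp. 45–46) -/

namespace TemperedGraphGroupData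

variable (D : TemperedGraphGroupData.{u})

/-- **Prop. 2.2, "in particular", from Prop. 2.1** (proof of Prop. 2.2, first sentence, p. 45: "by
allowing, in Proposition 2.1, `Λ` to range over the open subgroups of any verticial [hence, in
particular, nontrivial compact!] subgroup of `Π^tp_𝔾`, we conclude from Proposition 2.1 that `Π^tp_𝔾`
is commensurably terminal in `Π̂_𝔾`").  The verticial subgroup enters as the hypothesis `hV`: an
infinite compact subgroup `V ⊆ Π^tp_𝔾` all of whose finite index subgroups are open (Rmk. 2.5.3 (iii)
(O3), p. 56: "since `H` is topologically finitely generated … every finite index subgroup of `H` is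
open in `H`" [NS]).  [cite: Mochizuki2012, Prop 2.2 p.45] -/
theorem tp_isCommensurablyTerminal_of_prop21 (h : D.ProfiniteConjugatesOfCompactSubgroups)
    (hV : ∃ V : Subgroup D.Tp, IsCompact (V : Set D.Tp) ∧ (V : Set D.Tp).Infinite ∧
      ∀ W : Subgroup ↥V, W.FiniteIndex → IsOpen (W : Set ↥V)) :
    IsCommensurablyTerminal D.ι.range := by
  obtain ⟨V, hVc, hVinf, hVopen⟩ := hV
  refine ⟨isCommensurablyTerminal_of_le fun γ hγ => ?_⟩
  -- `N := {t ∈ Π^tp | γ t γ⁻¹ ∈ Π^tp} = ι⁻¹(γ⁻¹ Π^tp γ)` has finite index in `Π^tp`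
  have hγ' : γ⁻¹ ∈ Subgroup.Commensurable.commensurator D.ι.range := inv_mem hγ
  rw [Subgroup.Commensurable.commensurator_mem_iff] at hγ'
  set N : Subgroup D.Tp := (ConjAct.toConjAct γ⁻¹ • D.ι.range).comap D.ι with hN
  haveI hNfi : N.FiniteIndex := ⟨by rw [hN, Subgroup.index_comap]; exact hγ'.1⟩
  -- apply Proposition 2.1 to the nontrivial compact subgroup `Λ := V ∩ N`
  obtain ⟨hΛc, hΛne, -⟩ := inf_isCompact_of_finiteIndex hVc hVinf hVopen N
  refine h.mem_of_conj_le (V ⊓ N) hΛc hΛne γ fun l hl => ?_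
  have hl' : D.ι l ∈ ConjAct.toConjAct γ⁻¹ • D.ι.range := hl.2
  rw [Subgroup.mem_pointwise_smul_iff_inv_smul_mem, ← ConjAct.toConjAct_inv, inv_inv,
    ConjAct.toConjAct_smul] at hl'
  exact hl'

/-- **Prop. 2.2, "[hence, also in `Π^tp_𝔾`]"**: the commensurable terminality of `Π^tp_ℍ` in `Π̂_𝔾`
implies that in `Π^tp_𝔾` (p. 45). [cite: Mochizuki2012, Prop 2.2 p.45] -/
theorem tpH_in_tp_of_tpH_in_hat (h : IsCommensurablyTerminal (D.TpH.map D.ι)) :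
    IsCommensurablyTerminal D.TpH :=
  ⟨of_map_injective D.ι D.ι_injective h.commensurator_eq⟩

/-- **Prop. 2.2, `C_{Π̂_𝔾}(Π^tp_ℍ) = Π^tp_ℍ`, from its printed inputs** (proof, pp. 45–46): given
(a) "`Π^tp_ℍ` is commensurably terminal in `Π̂_ℍ`" ["by applying this fact to `ℍ`", i.e. Prop. 2.1 for
the `ℍ`-data — an input here, since the data `D` carries `ℍ` only through `Π^tp_ℍ`, `Π̂_ℍ`],
(b) "`C_{Π̂_𝔾}(Π̂_ℍ) = Π̂_ℍ`" ["the evident pro-`Σ̂` analogue of [SemiAnbd], Corollary 2.7, (i)"], and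
(c) `Π̂_ℍ` is the closure of `Π^tp_ℍ` in `Π̂_𝔾` ["where we think of `Π̂_ℍ`, `Π̂_𝔾`, respectively, as the
pro-`Σ̂` completions of `Π^tp_ℍ`, `Π^tp_𝔾`"], the chain
`Π^tp_ℍ ⊆ C_{Π̂_𝔾}(Π^tp_ℍ) ⊆ C_{Π̂_𝔾}(Π̂_ℍ) = Π̂_ℍ`, `C_{Π̂_𝔾}(Π^tp_ℍ) ⊆ C_{Π̂_ℍ}(Π^tp_ℍ) = Π^tp_ℍ` gives the
commensurable terminality of `Π^tp_ℍ` in `Π̂_𝔾`. [cite: Mochizuki2012, Prop 2.2 p.46] -/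
theorem tpH_in_hat_of_closure (hH : IsCommensurablyTerminal ((D.TpH.map D.ι).subgroupOf D.HatH))
    (hHatH : IsCommensurablyTerminal D.HatH)
    (hcl : (D.TpH.map D.ι).topologicalClosure = D.HatH) :
    IsCommensurablyTerminal (D.TpH.map D.ι) := by
  refine ⟨of_subgroupOf D.tpH_le (fun γ hγ => ?_) hH.commensurator_eq⟩
  have h' := commensurator_le_topologicalClosure _ hγ
  rw [hcl, hHatH.commensurator_eq] at h'
  exact h'

/-- **Proposition 2.2 from Proposition 2.1 and the cited inputs** — the whole printed proof
(pp. 45–46) as one implication over the data `D`: Prop. 2.1 for `𝔾` (hypothesis `h21`) and a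
verticial subgroup `V` (`hV`, cf. `tp_isCommensurablyTerminal_of_prop21`) give
`C_{Π̂_𝔾}(Π^tp_𝔾) = Π^tp_𝔾`; the `ℍ`-instance of that fact (`hH`), "[SemiAnbd], Corollary 2.7, (i)"'s
pro-`Σ̂` analogue `C_{Π̂_𝔾}(Π̂_ℍ) = Π̂_ℍ` (`hHatH`) and `Π̂_ℍ = cl(Π^tp_ℍ)` (`hcl`) give
`C_{Π̂_𝔾}(Π^tp_ℍ) = Π^tp_ℍ`, "[hence, also in `Π^tp_𝔾`]".  Nothing about semi-graphs of anabelioids is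
proved here. [cite: Mochizuki2012, Prop 2.2 p.45] -/
theorem prop22_of_prop21 (h21 : D.ProfiniteConjugatesOfCompactSubgroups)
    (hV : ∃ V : Subgroup D.Tp, IsCompact (V : Set D.Tp) ∧ (V : Set D.Tp).Infinite ∧
      ∀ W : Subgroup ↥V, W.FiniteIndex → IsOpen (W : Set ↥V))
    (hH : IsCommensurablyTerminal ((D.TpH.map D.ι).subgroupOf D.HatH))
    (hHatH : IsCommensurablyTerminal D.HatH)
    (hcl : (D.TpH.map D.ι).topologicalClosure = D.HatH) :
    D.CommensuratorsOfDecompositionSubgroups where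
  hatH := hHatH
  tpH_in_hat := D.tpH_in_hat_of_closure hH hHatH hcl
  tpH_in_tp := D.tpH_in_tp_of_tpH_in_hat (D.tpH_in_hat_of_closure hH hHatH hcl)
  tp_in_hat := D.tp_isCommensurablyTerminal_of_prop21 h21 hV

/-- **Remark 2.2.2 from Prop. 2.1** (p. 46: the normal terminality of `Π^tp_𝔾` in `Π̂_𝔾`, "a
consequence of … also of Prop. 2.2", whose relevant clause follows from Prop. 2.1 by
`tp_isCommensurablyTerminal_of_prop21`). [cite: Mochizuki2012, Rmk 2.2.2 p.46] -/
theorem temperedNormallyTerminal_of_prop21 (h : D.ProfiniteConjugatesOfCompactSubgroups)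
    (hV : ∃ V : Subgroup D.Tp, IsCompact (V : Set D.Tp) ∧ (V : Set D.Tp).Infinite ∧
      ∀ W : Subgroup ↥V, W.FiniteIndex → IsOpen (W : Set ↥V)) :
    D.TemperedNormallyTerminal :=
  ⟨fun _ => (D.tp_isCommensurablyTerminal_of_prop21 h hV).isNormallyTerminal⟩

end TemperedGraphGroupData

/-! ### Corollary 2.3 (i), (iv); Proposition 2.4 (iii); Corollary 2.5 (pp. 47–51) -/

namespace StableCurveTemperedData

variable (D : StableCurveTemperedData.{u})

/-- **Cor. 2.3 (i) from Prop. 2.2** (proof, p. 48: "Assertion (i) follows immediately from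
Proposition 2.2"): `Δ^tp_{X,ℍ} = (Δ^tp_X ↠ Π^tp_𝔾)⁻¹(Π^tp_ℍ)` and `Δ̂_{X,ℍ} = (Δ̂_X ↠ Π̂_𝔾)⁻¹(Π̂_ℍ)` are
commensurably terminal because `Π^tp_ℍ ⊆ Π^tp_𝔾`, `Π̂_ℍ ⊆ Π̂_𝔾` are.
[cite: Mochizuki2012, Cor 2.3(i) p.48] -/
theorem cor23i_of_prop22 (h : D.graph.CommensuratorsOfDecompositionSubgroups) : D.Cor23i where
  tp := ⟨comap_of_surjective D.ρTp D.ρTp_surjective h.tpH_in_tp.commensurator_eq⟩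
  hat := ⟨comap_of_surjective D.ρHat D.ρHat_surjective h.hatH.commensurator_eq⟩

/-- **Cor. 2.3 (iii), exactness at `Δ_{X,ℍ}`, from Cor. 2.3 (i)**: with `Π^tp_{X,ℍ} := N_{Π^tp_X}(Δ^tp_{X,ℍ})`,
`Π̂_{X,ℍ} := N_{Π̂_X}(Δ̂_{X,ℍ})` (the statement file's rendering of "defined so as to render the sequences
exact", p. 47), `Π_{X,ℍ} ∩ Δ_X = Δ_{X,ℍ}` because a commensurably terminal subgroup is normally
terminal.  [The other half of exactness, `Π_{X,ℍ} ↠ G_k`, is the "in particular" of Cor. 2.3 (i) —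
the outer `G_k`-action descends to `Δ_{X,ℍ}` — and is not derivable from the bare data.]
[cite: Mochizuki2012, Cor 2.3(iii) p.47] -/
theorem piXH_inf_delta_of_cor23i (hi : D.Cor23i) :
    D.piTpXH ⊓ D.DeltaTp = D.deltaTpH.map D.DeltaTp.subtype ∧
      D.piHatXH ⊓ D.DeltaHat = D.deltaHatH.map D.DeltaHat.subtype :=
  ⟨normalizer_inf_eq_of_isNormallyTerminal D.DeltaTp D.deltaTpH
      hi.tp.isNormallyTerminal.normalizer_eq,
    normalizer_inf_eq_of_isNormallyTerminal D.DeltaHat D.deltaHatH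
      hi.hat.isNormallyTerminal.normalizer_eq⟩

/-- **Cor. 2.3 (iv) from Cor. 2.3 (i)** and the surjectivity `Π_{X,ℍ} ↠ G_k` (proof, p. 49: "In light
of the exact sequences of assertion (iii), assertion (iv) follows immediately from assertion (i)";
the exactness at `Δ_{X,ℍ}` being itself a consequence of (i), `piXH_inf_delta_of_cor23i`).
[cite: Mochizuki2012, Cor 2.3(iv) p.49] -/
theorem cor23iv_of_cor23i_of_surjective (hi : D.Cor23i)
    (htp : D.Cor23Hyp → Function.Surjective (D.prTp.comp D.piTpXH.subtype))
    (hhat : D.Cor23Hyp → Function.Surjective (D.prHat.comp D.piHatXH.subtype)) : D.Cor23iv where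
  tp hyp := ⟨isCommensurablyTerminal_of_inf_ker D.prTp D.piTpXH D.deltaTpH hi.tp.commensurator_eq
    (D.piXH_inf_delta_of_cor23i hi).1 (htp hyp)⟩
  hat hyp := ⟨isCommensurablyTerminal_of_inf_ker D.prHat D.piHatXH D.deltaHatH
    hi.hat.commensurator_eq (D.piXH_inf_delta_of_cor23i hi).2 (hhat hyp)⟩

/-- **Cor. 2.3 (iv) from Cor. 2.3 (i) and the exact sequences of (iii)** (proof, p. 49: "In light of
the exact sequences of assertion (iii), assertion (iv) follows immediately from assertion (i)").
[cite: Mochizuki2012, Cor 2.3(iv) p.49] -/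
theorem cor23iv_of_cor23i (hi : D.Cor23i) (hiii : D.Cor23iii) : D.Cor23iv :=
  D.cor23iv_of_cor23i_of_surjective hi (fun hyp => (hiii.exact_tp hyp).2)
    fun hyp => (hiii.exact_hat hyp).2

/-- `prHat (ιX t) = prTp t` (the compatibility `prHat ∘ ιX = prTp` of the data, pointwise).
[cite: Mochizuki2012, §2 p.47] -/
theorem prHat_ιX (t : D.PiTp) : D.prHat (D.ιX t) = D.prTp t := by
  rw [← MonoidHom.comp_apply, D.prHat_comp]

/-- Inside `Π̂_X`: `Π^tp_X ∩ Δ̂_X = Δ^tp_X` (as images). [cite: Mochizuki2012, §2 p.47] -/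
theorem range_inf_deltaHat : D.ιX.range ⊓ D.DeltaHat = D.ιΔ.range.map D.DeltaHat.subtype := by
  ext y
  constructor
  · rintro ⟨⟨t, rfl⟩, hy⟩
    have ht : t ∈ D.DeltaTp := by
      rw [MonoidHom.mem_ker, ← D.prHat_ιX]; exact hy
    exact ⟨⟨D.ιX t, hy⟩, ⟨⟨t, ht⟩, Subtype.ext rfl⟩, rfl⟩
  · rintro ⟨z, ⟨d, rfl⟩, rfl⟩
    exact ⟨⟨(d : D.PiTp), rfl⟩, (D.ιΔ d).2⟩

/-- `Π^tp_X ↪ Π̂_X ↠ G_k` is surjective (since `Π^tp_X ↠ G_k` is). [cite: Mochizuki2012, §2 p.47] -/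
theorem prHat_comp_range_surjective :
    Function.Surjective (D.prHat.comp D.ιX.range.subtype) := by
  intro g
  obtain ⟨t, rfl⟩ := D.prTp_surjective g
  exact ⟨⟨D.ιX t, ⟨t, rfl⟩⟩, D.prHat_ιX t⟩

/-- **Prop. 2.4 (iii): the `Π`-statement from the `Δ`-statement** (proof, p. 51: "The commensurable
terminality of `Π^tp_X` in `Π̂_X` then follows immediately from the commensurable terminality of
`Δ^tp_X` in `Δ̂_X`"). [cite: Mochizuki2012, Prop 2.4(iii) p.51] -/
theorem prop24iii_of_delta (h : IsCommensurablyTerminal D.ιΔ.range) : D.Prop24iii where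
  delta := h
  pi := ⟨isCommensurablyTerminal_of_inf_ker D.prHat D.ιX.range D.ιΔ.range h.commensurator_eq
    D.range_inf_deltaHat D.prHat_comp_range_surjective⟩

/-- `ιΔ` is `ιX` on underlying elements. [cite: Mochizuki2012, §2 p.47] -/
theorem coe_ιΔ (d : D.DeltaTp) : ((D.ιΔ d : D.DeltaHat) : D.PiHat) = D.ιX d := rfl

/-- A conjugate `γ y γ⁻¹ ∈ Π̂_X` of an element `y` with trivial image in `G_k` that lies in `Π^tp_X`
lies in `Δ^tp_X`. [cite: Mochizuki2012, §2 p.47] -/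
theorem conj_mem_map_deltaTp {γ y : D.PiHat} (hy : D.prHat y = 1)
    (hmem : γ * y * γ⁻¹ ∈ D.ιX.range) : γ * y * γ⁻¹ ∈ D.DeltaTp.map D.ιX := by
  obtain ⟨s, hs⟩ := hmem
  refine ⟨s, ?_, hs⟩
  show s ∈ D.prTp.ker
  rw [MonoidHom.mem_ker, ← D.prHat_ιX, hs, map_mul, map_mul, map_inv, hy, mul_one,
    mul_inv_cancel]

/-- **Cor. 2.5 (decomposition groups) from Prop. 2.4 (ii)** (proof, p. 51: "Since `D_x` is compact
and surjects onto an open subgroup of `G_k`, it thus follows from Proposition 2.4, (ii), that a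
`Π̂_X`-conjugate of `D_x` is contained in `Π^tp_X` if and only if it is, in fact, a `Π^tp_X`-conjugate of
`D_x`, and that a `Π̂_X`-conjugate of `Π^tp_X` contains `D_x` if and only if it is, in fact, equal to
`Π^tp_X`").  The printed properties of the decomposition groups `D_x` — compact, [nontrivial], with
open image in `G_k` — are the hypothesis `hD`; `X` has a closed point or cusp (`Nonempty D.Pt`).
[cite: Mochizuki2012, Cor 2.5 p.51] -/
theorem cor25Decomposition_of_prop24ii (h : D.Prop24ii) [Nonempty D.Pt]
    (hD : ∀ x : D.Pt, IsCompact (D.decompTp x : Set D.PiTp) ∧ D.decompTp x ≠ ⊥ ∧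
      IsOpen ((D.decompTp x).map D.prTp : Set D.Gk)) :
    D.Cor25Decomposition where
  le_iff hS x γ := by
    obtain ⟨hc, hne, ho⟩ := hD x
    constructor
    · intro hle
      have hγ : γ ∈ D.ιX.range := by
        refine h.mem_of_conj_le hS (D.decompTp x) hc hne ho γ fun l hl => hle ?_
        exact Subgroup.smul_mem_pointwise_smul _ _ _ ⟨l, hl, rfl⟩
      obtain ⟨t, rfl⟩ := hγ
      exact ⟨x, t, (map_conj_smul D.ιX t (D.decompTp x)).symm⟩
    · rintro ⟨x', t, he⟩
      rw [he]
      exact Subgroup.map_le_range _ _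
  conj_eq_iff hS γ := by
    constructor
    · rintro ⟨x, t, hle⟩
      obtain ⟨hc, hne, ho⟩ := hD x
      -- apply Prop. 2.4 (ii) to `Λ = D_x` and `γ' := γ⁻¹ · t`
      have hγ' : γ⁻¹ * D.ιX t ∈ D.ιX.range := by
        refine h.mem_of_conj_le hS (D.decompTp x) hc hne ho _ fun l hl => ?_
        have hmem : D.ιX (t * l * t⁻¹) ∈ MulAut.conj γ • D.ιX.range :=
          hle ⟨t * l * t⁻¹, Subgroup.smul_mem_pointwise_smul _ _ _ hl, rfl⟩
        rw [Subgroup.mem_pointwise_smul_iff_inv_smul_mem, MulAut.smul_def,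
          MulAut.conj_inv_apply] at hmem
        simpa only [map_mul, map_inv, mul_inv_rev, inv_inv, mul_assoc] using hmem
      have hγmem : γ ∈ D.ιX.range := by
        have e : γ = D.ιX t * (γ⁻¹ * D.ιX t)⁻¹ := by
          rw [mul_inv_rev, inv_inv, mul_inv_cancel_left]
        rw [e]
        exact mul_mem ⟨t, rfl⟩ (inv_mem hγ')
      exact Subgroup.conj_smul_eq_self_of_mem hγmem
    · intro heq
      obtain ⟨x⟩ := ‹Nonempty D.Pt›
      refine ⟨x, 1, ?_⟩
      rw [map_one, one_smul, heq]
      exact Subgroup.map_le_range _ _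

/-- **Cor. 2.5 (inertia groups of cusps) from Prop. 2.4 (i)** (proof, p. 51: "when `x` is a cusp of
`X` [so `I_x ≅ ℤ̂`], it follows — i.e., by applying Proposition 2.4, (i), to the unique maximal
pro-`Σ` subgroup of `I_x` — that a `Π̂_X`-conjugate of `I_x` is contained in `Π^tp_X` if and only if it
is, in fact, a `Π^tp_X`-conjugate of `I_x`, and that a `Π̂_X`-conjugate of `Π^tp_X` contains `I_x` if and
only if it is, in fact, equal to `Π^tp_X`").  The pro-`Σ` part of `I_x` — a nontrivial [`Σ ≠ ∅`]
compact pro-`Σ` subgroup `P ⊆ I_x` — is the hypothesis `hI`; `X` has a cusp (`Nonempty D.Cusp`).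
[cite: Mochizuki2012, Cor 2.5 p.51] -/
theorem cor25Inertia_of_prop24i (h : D.Prop24i) [Nonempty D.Cusp]
    (hI : ∀ x : D.Cusp, ∃ P : Subgroup D.DeltaTp, P ≤ D.inertiaTp x ∧
      IsCompact (P : Set D.DeltaTp) ∧ P ≠ ⊥ ∧ IsProSigma D.graph.Sigma P) :
    D.Cor25Inertia where
  le_iff hS x γ := by
    obtain ⟨P, hPI, hPc, hPne, hPS⟩ := hI x
    constructor
    · intro hle
      have hγ : γ ∈ D.ιX.range := by
        refine h.mem_of_conj_le P hPc hPne hPS γ fun p hp => ?_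
        refine D.conj_mem_map_deltaTp (by rw [D.prHat_ιX]; exact p.2) (hle ?_)
        exact Subgroup.smul_mem_pointwise_smul _ _ _ ⟨(p : D.PiTp), ⟨p, hPI hp, rfl⟩, rfl⟩
      obtain ⟨t, rfl⟩ := hγ
      exact ⟨x, t, (map_conj_smul D.ιX t _).symm⟩
    · rintro ⟨x', t, he⟩
      rw [he]
      exact Subgroup.map_le_range _ _
  conj_eq_iff hS γ := by
    constructor
    · rintro ⟨x, t, hle⟩
      obtain ⟨P, hPI, hPc, hPne, hPS⟩ := hI x
      -- apply Prop. 2.4 (i) to `Λ = P` and `γ' := γ⁻¹ · t`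
      have hγ' : γ⁻¹ * D.ιX t ∈ D.ιX.range := by
        refine h.mem_of_conj_le P hPc hPne hPS _ fun p hp => ?_
        refine D.conj_mem_map_deltaTp (by rw [D.prHat_ιX]; exact p.2) ?_
        have hmem : D.ιX (t * (p : D.PiTp) * t⁻¹) ∈ MulAut.conj γ • D.ιX.range :=
          hle ⟨t * p * t⁻¹, Subgroup.smul_mem_pointwise_smul _ _ _ ⟨p, hPI hp, rfl⟩, rfl⟩
        rw [Subgroup.mem_pointwise_smul_iff_inv_smul_mem, MulAut.smul_def,
          MulAut.conj_inv_apply] at hmem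
        simpa only [map_mul, map_inv, mul_inv_rev, inv_inv, mul_assoc] using hmem
      have hγmem : γ ∈ D.ιX.range := by
        have e : γ = D.ιX t * (γ⁻¹ * D.ιX t)⁻¹ := by
          rw [mul_inv_rev, inv_inv, mul_inv_cancel_left]
        rw [e]
        exact mul_mem ⟨t, rfl⟩ (inv_mem hγ')
      exact Subgroup.conj_smul_eq_self_of_mem hγmem
    · intro heq
      obtain ⟨x⟩ := ‹Nonempty D.Cusp›
      refine ⟨x, 1, ?_⟩
      rw [map_one, one_smul, heq]
      exact Subgroup.map_le_range _ _

end StableCurveTemperedData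

end Literature.IUT.HodgeTheaters
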